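import Mathlib
import HarnessLib
import Literature.MathematicalPhysics.QuantumLattice.KohnLuttinger
import Summits.HubbardSuperconductivity.HubbardSuperconductivity.Theorems.WeakCouplingBCSWcbcsKohnLuttingerB1gReduction

/-!
# `stub_klFiniteMeasure`: the Fermi-curve measure of the nearest-neighbour band is finite

For `ε₀ = squareDispersion 1 0` and `μ ∈ (-4, 0)`, granted the gradient formula
`∇ε₀(k) = (2 sin k₀, 2 sin k₁)` and the finite length `μH[1] F < ∞` of the Fermi curve
`F = {k ∈ [-π,π)² | ε₀ k = μ}`, the density-of-states measure `σ = ‖∇ε₀‖⁻¹ · μH[1]⌊F` is finite: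
on `F` one has `cos k₀ + cos k₁ = -μ/2`, hence `‖∇ε₀(k)‖² = 4 (sin² k₀ + sin² k₁) ≥ -μ (4 + μ) > 0`,
so the density `‖∇ε₀‖⁻¹ ≤ (√(-μ(4+μ)))⁻¹` is bounded on `F` and `σ(univ) ≤ (√(-μ(4+μ)))⁻¹ · μH[1] F < ∞`.
-/

noncomputable section

set_option linter.dupNamespace false

namespace Summit.HubbardSuperconductivity.HubbardSuperconductivity.Theorems

open MeasureTheory Literature.MathematicalPhysics.QuantumLattice

/-- On the level set `ε₀ k = μ` of the nearest-neighbour band the squared Fermi speed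
`(2 sin k₀)² + (2 sin k₁)²` is at least `-μ (4 + μ)`: with `a = cos k₀`, `b = cos k₁`,
`a + b = -μ/2`, this is `8 (1 - a) (1 - b) ≥ 0`. [folklore] -/
theorem kl_fm_speed_sq_lower {μ : ℝ} {k : Momentum} (hk : squareDispersion 1 0 k = μ) :
    -μ * (4 + μ) ≤ (2 * Real.sin (k 0)) ^ 2 + (2 * Real.sin (k 1)) ^ 2 := by
  have h : μ = -2 * (Real.cos (k 0) + Real.cos (k 1)) := by
    rw [← hk]
    unfold squareDispersion
    ring
  subst h
  nlinarith [mul_nonneg (sub_nonneg.2 (Real.cos_le_one (k 0))) (sub_nonneg.2 (Real.cos_le_one (k 1))),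
    Real.sin_sq_add_cos_sq (k 0), Real.sin_sq_add_cos_sq (k 1)]

/-- The Euclidean norm of the vector `(a, b) ∈ ℝ²`: `‖(a, b)‖² = a² + b²`. [folklore] -/
theorem kl_fm_norm_sq_toLp (a b : ℝ) :
    ‖(WithLp.toLp 2 ![a, b] : Momentum)‖ ^ 2 = a ^ 2 + b ^ 2 := by
  rw [EuclideanSpace.real_norm_sq_eq, Fin.sum_univ_two]
  simp

/-- Granted the gradient formula, the inverse Fermi speed of `ε₀` is bounded on the Fermi curve at
`μ ∈ (-4, 0)`: `‖∇ε₀(k)‖⁻¹ ≤ (√(-μ (4 + μ)))⁻¹` for `k ∈ F`. [folklore] -/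
theorem kl_fm_inv_speed_le
    (hgrad : ∀ k : Momentum,
      gradient (squareDispersion 1 0) k = WithLp.toLp 2 ![2 * Real.sin (k 0), 2 * Real.sin (k 1)])
    {μ : ℝ} (hμ : μ ∈ Set.Ioo (-4 : ℝ) 0) {k : Momentum}
    (hk : k ∈ fermiCurve (squareDispersion 1 0) μ) :
    ‖gradient (squareDispersion 1 0) k‖⁻¹ ≤ (Real.sqrt (-μ * (4 + μ)))⁻¹ := by
  have hm : 0 < -μ * (4 + μ) := mul_pos (by linarith [hμ.2]) (by linarith [hμ.1])
  have hsq : -μ * (4 + μ) ≤ ‖gradient (squareDispersion 1 0) k‖ ^ 2 := by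
    rw [hgrad k, kl_fm_norm_sq_toLp]
    exact kl_fm_speed_sq_lower (mem_fermiCurve_iff.1 hk).2
  have hle : Real.sqrt (-μ * (4 + μ)) ≤ ‖gradient (squareDispersion 1 0) k‖ := by
    rw [← Real.sqrt_sq (norm_nonneg (gradient (squareDispersion 1 0) k))]
    exact Real.sqrt_le_sqrt hsq
  exact inv_anti₀ (Real.sqrt_pos.2 hm) hle

/-- **Stub `stub_klFiniteMeasure`**: granted the gradient formula and the finite length, the
density-of-states measure `σ = ‖∇ε₀‖⁻¹ · μH[1]⌊F` is finite for `μ ∈ (-4, 0)`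
(`‖∇ε₀‖² = 4(sin² k₀ + sin² k₁) ≥ 4c(2-c) > 0` on `F`, `c = -μ/2`). [folklore] -/
theorem stub_klFiniteMeasure :
    (∀ k : Momentum, gradient (squareDispersion 1 0) k = WithLp.toLp 2 ![2 * Real.sin (k 0), 2 * Real.sin (k 1)]) →
    (∀ μ ∈ Set.Ioo (-4 : ℝ) 0, Measure.hausdorffMeasure 1 (fermiCurve (squareDispersion 1 0) μ) < ⊤) →
    ∀ μ ∈ Set.Ioo (-4 : ℝ) 0, IsFiniteMeasure (fermiCurveMeasure (squareDispersion 1 0) μ) := by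
  intro hgrad hH μ hμ
  unfold fermiCurveMeasure
  refine isFiniteMeasure_withDensity (ne_of_lt ?_)
  have hF : MeasurableSet (fermiCurve (squareDispersion 1 0) μ) :=
    measurableSet_fermiCurve (measurable_squareDispersion 1 0) μ
  calc ∫⁻ k in fermiCurve (squareDispersion 1 0) μ,
        ENNReal.ofReal (‖gradient (squareDispersion 1 0) k‖⁻¹) ∂(Measure.hausdorffMeasure 1)
      ≤ ∫⁻ _ in fermiCurve (squareDispersion 1 0) μ,
        ENNReal.ofReal ((Real.sqrt (-μ * (4 + μ)))⁻¹) ∂(Measure.hausdorffMeasure 1) :=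
        setLIntegral_mono' hF fun k hk => ENNReal.ofReal_le_ofReal (kl_fm_inv_speed_le hgrad hμ hk)
    _ = ENNReal.ofReal ((Real.sqrt (-μ * (4 + μ)))⁻¹) *
        Measure.hausdorffMeasure 1 (fermiCurve (squareDispersion 1 0) μ) := setLIntegral_const _ _
    _ < ⊤ := ENNReal.mul_lt_top ENNReal.ofReal_lt_top (hH μ hμ)

end Summit.HubbardSuperconductivity.HubbardSuperconductivity.Theorems

end
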